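import Summits.ValiantsHypothesis.ValiantsHypothesis.Theorems.FifoMatchingNNDivisionHardExactPencilZgenCube
import HarnessLib
import Summits.ValiantsHypothesis.ValiantsHypothesis.Theorems.FifoMatchingNNDivisionHardShadowConstReadTwinFibre

/-!
# EXACT PENCILS VI — ★★★ SCALED / zero generators: the zonotope shape `Q₀ + Σ_t [0, c_t·(E^s_{kl} − E^s_{km})]` is DECIDED by C′ (crux `NNDivisionHard`, stmt-ValiantsHypothesis-21181) — `ExactPencil` port part 6/12

Theorems-side port (staged by val-idea-40 g6, C′-census owner per director-valiant R331 (2)(e) / desk #399, for the port hands;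
press as `Theorems/FifoMatchingNNDivisionHardExactPencilScaledZgenCube.lean`, `--kind proof --supports stmt-ValiantsHypothesis-21181 --as helper`; sig-first val-idea-crit-9 g3) of
§9b of val-idea-38 g2's crux workfile `Cruxes/NNDivisionHard/ExactPencil38.lean` REV 16 @4e81d1716f6b (sha16 d9f2e288279a0b09, 3 456 l., FROZEN — final from 38 g2, bus 01:14:51Z; critic of record val-idea-crit-9 g2/g3: `CRITIC-wave6.md` FINAL + V#97 §2 «rev 14/15 δ KERNEL VERIFIED»).  Declaration texts VERBATIM (namespace
`…Theorems.FifoMatching.ExactPencil`; one-line docstrings added where the source had none); the 40-g5 tools the source RESTATED are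
DROPPED here and cited BY NAME from the landed ports `…Theorems.FifoMatching.LocatedRows.*` (✓ p680125 … p683387: `T`, `RowFamily`,
`hCOR`, `exactTilted`, `ExactPencilLaw`, `pinnedRows`, `unflat`, `three_pow_le_of_block`, `two_pow_half_mul_le`, `zgen`, `cubePt`, …) and
`…Theorems.FifoMatching.XcDivision` (`udRow`, `udPt`, `udInd`, `udMat`, …), so that C′ stays ONE Theorems declaration
`LocatedRows.ExactPencilLaw`.  Part 6/12 of the port (imports part 5, `…Theorems.FifoMatchingNNDivisionHardExactPencilZgenCube`).

* `IsScaledZgenCube`, `isScaledZgenCube_of_isZgenCube`, (the source's `LocatedRows.flat_smul'`/`ShadowConstRead.flat_zero₄₁` = the landed `LocatedRows.flat_smul'` / `ShadowConstRead.flat_zero₄₁`, deduplicated at the gate by the presser), `Lrow`, ★ `zscore_sign'`, `Hz'`, `zscore'_nonneg_of_mem`,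
  `zscore'_nonpos_of_not_mem`, ★ `zsc_le_star'`, ★★ `exactTilted_block_scaledZgenCube`, ★★★ `exactTilted_law_holds_on_scaledZgenCube`,
  ★★★ `cor_add_scaledZgenCube_decided`.

HONEST LABEL: every theorem here is a DECIDED SPECIES / support lemma for the OPEN law C′ = `LocatedRows.ExactPencilLaw`
(`exactTilted.Law`); the crux 21181 `NNDivisionHard`, C′, `allRows.Law` and COR-VIRTUAL are OPEN; C⁺_entry `LocatedPencilLaw` is
REFUTED (✓ p679540).  VP ≠ VNP is NOT proved here or anywhere in this tree.
-/

set_option autoImplicit false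

-- the mandated summit-side namespace repeats a component by design (single-problem summit)
set_option linter.dupNamespace false

noncomputable section

open Matrix Finset
open scoped Pointwise

namespace Summit.ValiantsHypothesis.ValiantsHypothesis.Theorems.FifoMatching.ExactPencil

open Literature.Barriers.PneNP (HasEFOfSize three_pow_le_card_mul_two_pow_of_cover_univ)
open Literature.Combinatorics.Optimization.FixedSizePsdRank
  (corPolytope flat vecOuter flat_dotProduct_le_of_mem_corPolytope flat_dotProduct_vecOuter)
open Summit.ValiantsHypothesis.ValiantsHypothesis.Theorems.FifoMatching.XcDivision
  (udRow udPt udInd udMat ud_data udInd_apply udInd_sq dot_le_of_mem_convexHull flat_dotProduct_flat)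
open Summit.ValiantsHypothesis.ValiantsHypothesis.Theorems.FifoMatching.LocatedRows
  (T CorVirtualHardN RowFamily corVirtualHardN_of_law flat_le_box entryTilted allRows LocatedPencilLaw
    hCOR le_hCOR exists_eq_hCOR flat_le_hCOR hCOR_le_box exactTilted ExactPencilLaw exactTilted_emb_allRows
    corVirtualHardN_of_exactPencilLaw three_pow_le_of_block two_pow_half_mul_le pinnedRows unflat flat_unflat
    pinnedRows_emb_exactTilted corVirtualHardN_of_pinnedRowsLaw zgen cubePt dotProduct_cubePt)

section ZgenCube
variable {n : ℕ}

/-! ### §9b (rev 7) scaled and zero generators — the zonotope shape `Q₀ + Σ_t [0, c_t·(E^s_{kl} − E^s_{km})]`, `c_t > 0` -/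

/-- «every generator is `0` or a POSITIVE multiple of a zero-diagonal difference `E^s_{kl} − E^s_{km}`». -/
def IsScaledZgenCube {N : ℕ} (G : Fin N → Matrix (Fin n) (Fin n) ℝ) : Prop :=
  ∀ t, G t = 0 ∨ ∃ c : ℝ, 0 < c ∧ ∃ k l m : Fin n, k ≠ l ∧ k ≠ m ∧ l ≠ m ∧ G t = c • zgen k l m

/-- a zgen cube is a scaled zgen cube (all scales `1`). -/
theorem isScaledZgenCube_of_isZgenCube {N : ℕ} {G : Fin N → Matrix (Fin n) (Fin n) ℝ} (hz : IsZgenCube G) :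
    IsScaledZgenCube G := fun t => by
  obtain ⟨k, l, m, hkl, hkm, hlm, hG⟩ := hz t
  exact Or.inr ⟨1, one_pos, k, l, m, hkl, hkm, hlm, by rw [hG, one_smul]⟩

/-- the full left block row `L = ι₁([k])`. -/
def Lrow (n : ℕ) : Finset (Fin n) := (Finset.univ : Finset (Fin (kk n))).map (ι₁e n)

/-- `x ∈ Lrow n ↔ x < ⌊n/2⌋` (the first half). -/
theorem mem_Lrow_iff (x : Fin n) : x ∈ Lrow n ↔ (x : ℕ) < kk n := by
  constructor
  · exact fun hx => val_lt_of_mem_map_ι₁e hx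
  · intro hx
    exact Finset.mem_map.mpr ⟨⟨x, hx⟩, Finset.mem_univ _, Fin.ext rfl⟩

/-- `ι₁(a') ⊆ Lrow n`. -/
theorem map_ι₁e_subset_Lrow (a' : Finset (Fin (kk n))) : a'.map (ι₁e n) ⊆ Lrow n := by
  intro x hx
  exact (mem_Lrow_iff x).mpr (val_lt_of_mem_map_ι₁e hx)

/-- ★ the SCORE SIGN of a scaled difference generator against a block row, under the index-free rule. -/
theorem zscore_sign' (a' : Finset (Fin (kk n))) {c : ℝ} (hc : 0 < c) {k l m : Fin n} (hkl : k ≠ l) (hkm : k ≠ m)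
    (hlm : l ≠ m) :
    ((0 < flat (Wz n) ⬝ᵥ flat (c • zgen k l m) ∨
        (flat (Wz n) ⬝ᵥ flat (c • zgen k l m) = 0 ∧ 0 ≤ udRow (Lrow n) ⬝ᵥ flat (c • zgen k l m))) →
        0 ≤ (udRow (a'.map (ι₁e n)) + flat (Wz n)) ⬝ᵥ flat (c • zgen k l m)) ∧
    (¬ (0 < flat (Wz n) ⬝ᵥ flat (c • zgen k l m) ∨
        (flat (Wz n) ⬝ᵥ flat (c • zgen k l m) = 0 ∧ 0 ≤ udRow (Lrow n) ⬝ᵥ flat (c • zgen k l m))) →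
        (udRow (a'.map (ι₁e n)) + flat (Wz n)) ⬝ᵥ flat (c • zgen k l m) ≤ 0) := by
  classical
  set a := a'.map (ι₁e n)
  have haL : a ⊆ Lrow n := map_ι₁e_subset_Lrow a'
  have hcw := abs_udRow_dotProduct_zgen_le a hkl hkm
  have htri := Wz_sub_trichotomy (n := n) k l m
  have hc0 : c ≠ 0 := hc.ne'
  have hpin : flat (Wz n) ⬝ᵥ flat (c • zgen k l m) = c * (2 * (Wz n k l - Wz n k m)) := by
    rw [LocatedRows.flat_smul', dotProduct_smul, smul_eq_mul, Wz_dotProduct_zgen hkl hkm]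
  have hL : udRow (Lrow n) ⬝ᵥ flat (c • zgen k l m) = c * (udRow (Lrow n) ⬝ᵥ flat (zgen k l m)) := by
    rw [LocatedRows.flat_smul', dotProduct_smul, smul_eq_mul]
  have hsc : (udRow a + flat (Wz n)) ⬝ᵥ flat (c • zgen k l m) =
      c * (udRow a ⬝ᵥ flat (zgen k l m) + 2 * (Wz n k l - Wz n k m)) := by
    rw [LocatedRows.flat_smul', dotProduct_smul, smul_eq_mul, add_dotProduct, Wz_dotProduct_zgen hkl hkm]
  rw [hpin, hL, hsc]
  have e1 : (0 < c * (2 * (Wz n k l - Wz n k m))) ↔ 0 < Wz n k l - Wz n k m := by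
    rw [mul_pos_iff_of_pos_left hc]
    constructor <;> intro h <;> linarith
  have e2 : (c * (2 * (Wz n k l - Wz n k m)) = 0) ↔ Wz n k l - Wz n k m = 0 := by
    constructor
    · intro h
      rcases mul_eq_zero.mp h with h | h
      · exact absurd h hc0
      · linarith
    · intro h; rw [h]; ring
  have e3 : (0 ≤ c * (udRow (Lrow n) ⬝ᵥ flat (zgen k l m))) ↔ 0 ≤ udRow (Lrow n) ⬝ᵥ flat (zgen k l m) :=
    mul_nonneg_iff_of_pos_left hc
  rw [e1, e2, e3]
  have hLw : udRow (Lrow n) ⬝ᵥ flat (zgen k l m) = 2 * udInd (Lrow n) k * (udInd (Lrow n) m - udInd (Lrow n) l) :=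
    udRow_dotProduct_zgen _ hkl hkm
  have haw : udRow a ⬝ᵥ flat (zgen k l m) = 2 * udInd a k * (udInd a m - udInd a l) := udRow_dotProduct_zgen _ hkl hkm
  constructor
  · rintro (hpos | ⟨hzero, hLnn⟩)
    · apply mul_nonneg hc.le
      rcases htri with h | h | h <;> linarith [hcw.1]
    · apply mul_nonneg hc.le
      rw [hzero, mul_zero, add_zero, haw, udInd_apply, udInd_apply, udInd_apply]
      by_cases hka : k ∈ a
      · by_cases hla : l ∈ a
        · exfalso
          have hkL := haL hka
          have hlL := haL hla
          rw [hLw, udInd_apply, udInd_apply, udInd_apply, if_pos hkL, if_pos hlL] at hLnn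
          have hmL : m ∈ Lrow n := by
            by_contra hm
            rw [if_neg hm] at hLnn
            norm_num at hLnn
          exact Wz_sub_ne_zero_of_lt ((mem_Lrow_iff k).mp hkL) ((mem_Lrow_iff l).mp hlL) ((mem_Lrow_iff m).mp hmL)
            hkl hkm hlm hzero
        · rw [if_pos hka, if_neg hla]
          split_ifs <;> norm_num
      · rw [if_neg hka]; simp
  · intro hnot
    push Not at hnot
    obtain ⟨hle, hzero_imp⟩ := hnot
    rcases htri with h | h | h
    · have hx : udRow a ⬝ᵥ flat (zgen k l m) + 2 * (Wz n k l - Wz n k m) ≤ 0 := by linarith [hcw.2]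
      nlinarith [mul_nonneg hc.le (show (0 : ℝ) ≤ -(udRow a ⬝ᵥ flat (zgen k l m) + 2 * (Wz n k l - Wz n k m)) by linarith)]
    · have hLneg := hzero_imp h
      rw [hLw, udInd_apply, udInd_apply, udInd_apply] at hLneg
      have hmL : m ∉ Lrow n := by
        intro hm
        rw [if_pos hm] at hLneg
        split_ifs at hLneg <;> norm_num at hLneg
      have hma : m ∉ a := fun hma => hmL (haL hma)
      rw [h, mul_zero, add_zero, haw, udInd_apply a m, if_neg hma, udInd_apply, udInd_apply]
      split_ifs <;> nlinarith [hc]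
    · exact absurd h (by linarith)

section ScaledCube
variable {N : ℕ} {G : Fin N → Matrix (Fin n) (Fin n) ℝ}

/-- ★ the INDEX-FREE common maximiser `H⋆' = {t : ⟨W^z, G t⟩ > 0} ∪ {t : ⟨W^z, G t⟩ = 0 ∧ ⟨udRow L, G t⟩ ≥ 0}`. -/
noncomputable def Hz' (G : Fin N → Matrix (Fin n) (Fin n) ℝ) : Finset (Fin N) :=
  Finset.univ.filter (fun t => 0 < flat (Wz n) ⬝ᵥ flat (G t) ∨
    (flat (Wz n) ⬝ᵥ flat (G t) = 0 ∧ 0 ≤ udRow (Lrow n) ⬝ᵥ flat (G t)))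

/-- membership in the common maximiser `H⋆'`: `⟨W^z, G t⟩ > 0`, or `= 0` with `⟨udRow (Lrow n), G t⟩ ≥ 0`. -/
theorem mem_Hz' (G : Fin N → Matrix (Fin n) (Fin n) ℝ) (t : Fin N) :
    t ∈ Hz' G ↔ (0 < flat (Wz n) ⬝ᵥ flat (G t) ∨ (flat (Wz n) ⬝ᵥ flat (G t) = 0 ∧ 0 ≤ udRow (Lrow n) ⬝ᵥ flat (G t))) := by
  simp [Hz']

/-- scores are `≥ 0` on `H⋆'` for every block row (scaled cube). -/
theorem zscore'_nonneg_of_mem (hz : IsScaledZgenCube G) (a' : Finset (Fin (kk n))) {t : Fin N} (ht : t ∈ Hz' G) :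
    0 ≤ (udRow (a'.map (ι₁e n)) + flat (Wz n)) ⬝ᵥ flat (G t) := by
  rcases hz t with h0 | ⟨c, hc, k, l, m, hkl, hkm, hlm, hG⟩
  · rw [h0, ShadowConstRead.flat_zero₄₁, dotProduct_zero]
  · have h := (mem_Hz' G t).mp ht
    rw [hG] at h ⊢
    exact (zscore_sign' a' hc hkl hkm hlm).1 h

/-- scores are `≤ 0` off `H⋆'` for every block row (scaled cube). -/
theorem zscore'_nonpos_of_not_mem (hz : IsScaledZgenCube G) (a' : Finset (Fin (kk n))) {t : Fin N} (ht : t ∉ Hz' G) :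
    (udRow (a'.map (ι₁e n)) + flat (Wz n)) ⬝ᵥ flat (G t) ≤ 0 := by
  rcases hz t with h0 | ⟨c, hc, k, l, m, hkl, hkm, hlm, hG⟩
  · rw [h0, ShadowConstRead.flat_zero₄₁, dotProduct_zero]
  · rw [hG]
    refine (zscore_sign' a' hc hkl hkm hlm).2 fun h => ht ((mem_Hz' G t).mpr ?_)
    rw [hG]; exact h

/-- ★ `H⋆'` maximises EVERY block row over a scaled zgen cube. -/
theorem zsc_le_star' (hz : IsScaledZgenCube G) (Q₀ : Matrix (Fin n) (Fin n) ℝ) (a' : Finset (Fin (kk n))) (P : Finset (Fin N)) :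
    (udRow (a'.map (ι₁e n)) + flat (Wz n)) ⬝ᵥ cubePt Q₀ G P ≤
      (udRow (a'.map (ι₁e n)) + flat (Wz n)) ⬝ᵥ cubePt Q₀ G (Hz' G) := by
  classical
  set ρ := udRow (a'.map (ι₁e n)) + flat (Wz n)
  rw [dotProduct_cubePt, dotProduct_cubePt]
  have hsplit := Finset.sum_filter_add_sum_filter_not P (fun t => t ∈ Hz' G) (fun t => ρ ⬝ᵥ flat (G t))
  have hneg : ∑ t ∈ P.filter (fun t => t ∉ Hz' G), ρ ⬝ᵥ flat (G t) ≤ 0 :=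
    Finset.sum_nonpos fun t ht => zscore'_nonpos_of_not_mem hz a' (Finset.mem_filter.mp ht).2
  have hsub : P.filter (fun t => t ∈ Hz' G) ⊆ Hz' G := fun t ht => (Finset.mem_filter.mp ht).2
  have hmono : ∑ t ∈ P.filter (fun t => t ∈ Hz' G), ρ ⬝ᵥ flat (G t) ≤ ∑ t ∈ Hz' G, ρ ⬝ᵥ flat (G t) :=
    Finset.sum_le_sum_of_subset_of_nonneg hsub fun t ht _ => zscore'_nonneg_of_mem hz a' ht
  linarith

/-- the block engine for scaled zgen cubes (columns `P ⊆ [N]`, no budget hypothesis). -/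
theorem exactTilted_block_scaledZgenCube (c : ℕ) : ∃ n₀ : ℕ, ∀ n ≥ n₀, ∀ (N : ℕ) (Q₀ : Matrix (Fin n) (Fin n) ℝ)
    (G : Fin N → Matrix (Fin n) (Fin n) ℝ), IsScaledZgenCube G → ∀ (r : ℕ)
    (mm : exactTilted.A n → ℝ), (∀ a P, exactTilted.ρ n a ⬝ᵥ cubePt Q₀ G P ≤ mm a) →
      (∀ a, ∃ P, exactTilted.ρ n a ⬝ᵥ cubePt Q₀ G P = mm a) →
    ∀ (U : exactTilted.A n → Option (Fin r) → ℝ) (V : Finset (Fin n) × Finset (Fin N) → Option (Fin r) → ℝ),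
      (∀ a i, 0 ≤ U a i) → (∀ p i, 0 ≤ V p i) →
      (∀ a b P, (exactTilted.β n a + mm a) - exactTilted.ρ n a ⬝ᵥ (udPt b + cubePt Q₀ G P) = ∑ i, U a i * V (b, P) i) →
      T c n < r := by
  classical
  obtain ⟨n₀, hn₀⟩ := T_lt_of_block_half c
  refine ⟨n₀, fun n hn N Q₀ G hz r mm hle hat U V hU hV hfac => hn₀ n hn r ?_⟩
  let row : Finset (Fin (kk n)) → exactTilted.A n := fun a' => (a'.map (ι₁e n), Wz n)
  let col : Finset (Fin (kk n)) → Finset (Fin n) × Finset (Fin N) := fun S => (Bcol S, Hz' G)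
  have hmm : ∀ a', mm (row a') = (udRow (a'.map (ι₁e n)) + flat (Wz n)) ⬝ᵥ cubePt Q₀ G (Hz' G) := by
    intro a'
    obtain ⟨P₀, hP₀⟩ := hat (row a')
    have h1 := hle (row a') (Hz' G)
    have h2 : exactTilted.ρ n (row a') ⬝ᵥ cubePt Q₀ G P₀ ≤ (udRow (a'.map (ι₁e n)) + flat (Wz n)) ⬝ᵥ cubePt Q₀ G (Hz' G) :=
      zsc_le_star' hz Q₀ _ P₀
    rw [hP₀] at h2
    exact le_antisymm h2 h1
  have key := three_pow_le_of_block (ι := Option (Fin r)) U V hU hV row col ?_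
  · simpa [Fintype.card_option, Fintype.card_fin] using key
  · intro a' S
    rw [← hfac (row a') (Bcol S) (Hz' G), hmm a']
    show ((1 + hCOR (Wz n)) + (udRow (a'.map (ι₁e n)) + flat (Wz n)) ⬝ᵥ cubePt Q₀ G (Hz' G)) -
        (udRow (a'.map (ι₁e n)) + flat (Wz n)) ⬝ᵥ (udPt (Bcol S) + cubePt Q₀ G (Hz' G)) = (1 - ((a' ∩ S).card : ℝ)) ^ 2
    rw [dotProduct_add, add_dotProduct _ _ (udPt (Bcol S)), hCOR_Wz, Wz_dotProduct_Bcol, ← ud_block a' S]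
    ring

/-- ★★★ `exactTilted.Law` HOLDS ON EVERY SCALED ZGEN CUBE (zero generators and positive multiples allowed). -/
theorem exactTilted_law_holds_on_scaledZgenCube : ∀ c : ℕ, ∃ n₀ : ℕ, ∀ n ≥ n₀,
    ∀ (N K : ℕ) (Q₀ : Matrix (Fin n) (Fin n) ℝ) (G : Fin N → Matrix (Fin n) (Fin n) ℝ), IsScaledZgenCube G →
    ∀ (e : Fin (K + 1) → Finset (Fin N)), Function.Surjective e → ∀ (r : ℕ),
    HasEFOfSize (convexHull ℝ (Set.range (cubePt Q₀ G ∘ e))) r →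
    ∀ mm : exactTilted.A n → ℝ, (∀ a j, exactTilted.ρ n a ⬝ᵥ (cubePt Q₀ G ∘ e) j ≤ mm a) →
      (∀ a, ∃ j, exactTilted.ρ n a ⬝ᵥ (cubePt Q₀ G ∘ e) j = mm a) →
    ∀ (U : exactTilted.A n → Option (Fin r) → ℝ) (V : Finset (Fin n) × Fin (K + 1) → Option (Fin r) → ℝ),
      (∀ a i, 0 ≤ U a i) → (∀ p i, 0 ≤ V p i) →
      (∀ a b j, (exactTilted.β n a + mm a) - exactTilted.ρ n a ⬝ᵥ (udPt b + (cubePt Q₀ G ∘ e) j) = ∑ i, U a i * V (b, j) i) →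
      T c n < r := by
  classical
  intro c
  obtain ⟨n₀, hn₀⟩ := T_lt_of_block_half c
  refine ⟨n₀, fun n hn N K Q₀ G hz e he r _ mm hle hat U V hU hV hfac => hn₀ n hn r ?_⟩
  obtain ⟨jstar, hj⟩ := he (Hz' G)
  let row : Finset (Fin (kk n)) → exactTilted.A n := fun a' => (a'.map (ι₁e n), Wz n)
  let col : Finset (Fin (kk n)) → Finset (Fin n) × Fin (K + 1) := fun S => (Bcol S, jstar)
  have hq : (cubePt Q₀ G ∘ e) jstar = cubePt Q₀ G (Hz' G) := by simp [hj]
  have hmm : ∀ a', mm (row a') = (udRow (a'.map (ι₁e n)) + flat (Wz n)) ⬝ᵥ cubePt Q₀ G (Hz' G) := by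
    intro a'
    obtain ⟨j₀, hj₀⟩ := hat (row a')
    have h1 := hle (row a') jstar
    rw [hq] at h1
    have h2 : exactTilted.ρ n (row a') ⬝ᵥ (cubePt Q₀ G ∘ e) j₀ ≤ (udRow (a'.map (ι₁e n)) + flat (Wz n)) ⬝ᵥ cubePt Q₀ G (Hz' G) :=
      zsc_le_star' hz Q₀ _ (e j₀)
    rw [hj₀] at h2
    exact le_antisymm h2 h1
  have key := three_pow_le_of_block (ι := Option (Fin r)) U V hU hV row col ?_
  · simpa [Fintype.card_option, Fintype.card_fin] using key
  · intro a' S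
    rw [← hfac (row a') (Bcol S) jstar, hq, hmm a']
    show ((1 + hCOR (Wz n)) + (udRow (a'.map (ι₁e n)) + flat (Wz n)) ⬝ᵥ cubePt Q₀ G (Hz' G)) -
        (udRow (a'.map (ι₁e n)) + flat (Wz n)) ⬝ᵥ (udPt (Bcol S) + cubePt Q₀ G (Hz' G)) = (1 - ((a' ∩ S).card : ℝ)) ^ 2
    rw [dotProduct_add, add_dotProduct _ _ (udPt (Bcol S)), hCOR_Wz, Wz_dotProduct_Bcol, ← ud_block a' S]
    ring

/-- ★★★ EVERY SCALED ZGEN CUBE IS DECIDED AT THE TOP LAW: `xc(COR(n) + Q) > T c n` eventually (`(3/2)^{⌊n/2⌋} ≤ r + 1`). -/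
theorem cor_add_scaledZgenCube_decided (c : ℕ) : ∃ n₀ : ℕ, ∀ n ≥ n₀, ∀ (N : ℕ) (Q₀ : Matrix (Fin n) (Fin n) ℝ)
    (G : Fin N → Matrix (Fin n) (Fin n) ℝ), IsScaledZgenCube G → ∀ r : ℕ,
    HasEFOfSize (corPolytope n + convexHull ℝ (Set.range (cubePt Q₀ G))) r → T c n < r := by
  classical
  obtain ⟨n₀, hn₀⟩ := exactTilted_block_scaledZgenCube c
  refine ⟨n₀, fun n hn N Q₀ G hz r hEF => ?_⟩
  obtain ⟨pt_mem, -, -, -⟩ := ud_data n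
  let mm : exactTilted.A n → ℝ := fun a =>
    Finset.univ.sup' Finset.univ_nonempty (fun P : Finset (Fin N) => exactTilted.ρ n a ⬝ᵥ cubePt Q₀ G P)
  have hat : ∀ a, ∃ P, exactTilted.ρ n a ⬝ᵥ cubePt Q₀ G P = mm a := fun a => by
    obtain ⟨P, -, hP⟩ := Finset.exists_mem_eq_sup' Finset.univ_nonempty
      (fun P : Finset (Fin N) => exactTilted.ρ n a ⬝ᵥ cubePt Q₀ G P)
    exact ⟨P, hP.symm⟩
  have hle : ∀ a P, exactTilted.ρ n a ⬝ᵥ cubePt Q₀ G P ≤ mm a := fun a P =>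
    Finset.le_sup' (fun P : Finset (Fin N) => exactTilted.ρ n a ⬝ᵥ cubePt Q₀ G P) (Finset.mem_univ P)
  have hm : ∀ a, ∀ y ∈ convexHull ℝ (Set.range (cubePt Q₀ G)), exactTilted.ρ n a ⬝ᵥ y ≤ mm a := fun a =>
    dot_le_of_mem_convexHull _ _ _ (by rintro _ ⟨P, rfl⟩; exact hle a P)
  have hq : ∀ P : Finset (Fin N), cubePt Q₀ G P ∈ convexHull ℝ (Set.range (cubePt Q₀ G)) :=
    fun P => subset_convexHull ℝ _ ⟨P, rfl⟩
  have hv : ∀ p : Finset (Fin n) × Finset (Fin N),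
      udPt p.1 + cubePt Q₀ G p.2 ∈ corPolytope n + convexHull ℝ (Set.range (cubePt Q₀ G)) :=
    fun p => Set.add_mem_add (pt_mem p.1) (hq p.2)
  have hvalid : ∀ a, ∀ x ∈ corPolytope n + convexHull ℝ (Set.range (cubePt Q₀ G)),
      exactTilted.ρ n a ⬝ᵥ x ≤ exactTilted.β n a + mm a := by
    rintro a x ⟨p, hp, y, hy, rfl⟩
    rw [dotProduct_add]
    exact add_le_add (exactTilted.valid n a p hp) (hm a y hy)
  obtain ⟨U, V, hU, hV, hfac⟩ := Literature.Barriers.PneNP.HasEFOfSize.exists_nonneg_factorization hEF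
    (fun p : Finset (Fin n) × Finset (Fin N) => udPt p.1 + cubePt Q₀ G p.2) hv (exactTilted.ρ n)
    (fun a => exactTilted.β n a + mm a) hvalid
  exact hn₀ n hn N Q₀ G hz r mm hle hat U V hU hV (fun a b P => hfac a (b, P))

end ScaledCube

end ZgenCube

end Summit.ValiantsHypothesis.ValiantsHypothesis.Theorems.FifoMatching.ExactPencil
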